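import Summits.Ventures.QEC.Census.CertChunks
import Summits.Ventures.QEC.Census.BB.BB72.Cert
import HarnessLib

/-!
# `BB72` — KERNEL-tier lower-bound replay, side X, leaf file 9/10 (emitted by qec-search-7)

Bruteforce replay (CERT-FORMAT v1 §5.1, lemma L3) of the certificate `7e943c5a566adc43`: every X-type operator of weight
`1 … 5` has nonzero syndrome (rows `cert.HZ`) or is allow-listed (allow-list []). This file holds
11 packed chunk evaluations (`chunk1R`/`chunk2R` of `Census/CertChunks.lean` over `posList 72 cert.HZ`), total
1507180 scan end points, each closed by `decide +kernel` — tier KERNEL (CERTIFIED): axioms ⊆ {propext, Classical.choice,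
Quot.sound}. Assembled in `BB/BB72/KernelX.lean`. Do not edit; re-emit (HOME/census/search-7/emit_kernel.py).
-/

namespace Summit.Ventures.QEC.Census.BB72

/-- Level-2 chunks `(20, j)`, `0 ≤ j < 14`, side X of `BB72` (197533 end points): pass. -/
theorem kX2_20_0 : chunk2R (leafTest []) (posList 72 cert.HZ) 3 20 0 14 = true := by decide +kernel

/-- Level-2 chunks `(20, j)`, `14 ≤ j < 51`, side X of `BB72` (74518 end points): pass. -/
theorem kX2_20_14 : chunk2R (leafTest []) (posList 72 cert.HZ) 3 20 14 37 = true := by decide +kernel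

/-- Level-2 chunks `(21, j)`, `0 ≤ j < 16`, side X of `BB72` (198220 end points): pass. -/
theorem kX2_21_0 : chunk2R (leafTest []) (posList 72 cert.HZ) 3 21 0 16 = true := by decide +kernel

/-- Level-2 chunks `(21, j)`, `16 ≤ j < 50`, side X of `BB72` (52955 end points): pass. -/
theorem kX2_21_16 : chunk2R (leafTest []) (posList 72 cert.HZ) 3 21 16 34 = true := by decide +kernel

/-- Level-2 chunks `(22, j)`, `0 ≤ j < 19`, side X of `BB72` (199595 end points): pass. -/
theorem kX2_22_0 : chunk2R (leafTest []) (posList 72 cert.HZ) 3 22 0 19 = true := by decide +kernel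

/-- Level-2 chunks `(22, j)`, `19 ≤ j < 49`, side X of `BB72` (31930 end points): pass. -/
theorem kX2_22_19 : chunk2R (leafTest []) (posList 72 cert.HZ) 3 22 19 30 = true := by decide +kernel

/-- Level-2 chunks `(23, j)`, `0 ≤ j < 23`, side X of `BB72` (197777 end points): pass. -/
theorem kX2_23_0 : chunk2R (leafTest []) (posList 72 cert.HZ) 3 23 0 23 = true := by decide +kernel

/-- Level-2 chunks `(23, j)`, `23 ≤ j < 48`, side X of `BB72` (15275 end points): pass. -/
theorem kX2_23_23 : chunk2R (leafTest []) (posList 72 cert.HZ) 3 23 23 25 = true := by decide +kernel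

/-- Level-1 chunks `i`, `24 ≤ i < 25`, side X of `BB72` (195709 end points): pass. -/
theorem kX1_24 : chunk1R (leafTest []) (posList 72 cert.HZ) 4 24 1 = true := by decide +kernel

/-- Level-1 chunks `i`, `25 ≤ i < 26`, side X of `BB72` (179447 end points): pass. -/
theorem kX1_25 : chunk1R (leafTest []) (posList 72 cert.HZ) 4 25 1 = true := by decide +kernel

/-- Level-1 chunks `i`, `26 ≤ i < 27`, side X of `BB72` (164221 end points): pass. -/
theorem kX1_26 : chunk1R (leafTest []) (posList 72 cert.HZ) 4 26 1 = true := by decide +kernel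

end Summit.Ventures.QEC.Census.BB72
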